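import Mathlib
import Summits.Schanuel.Schanuel.Theorems.AclSubsetLogFreeCore.Negative.LogFreeCoreCountable
import Literature.NumberTheory.Transcendental.ZilberFieldQuasiminimal

/-!
# Crux `AclSubsetLogFreeCore` — complex conjugation is an automorphism of the countable core `C₀ = ecl ∅`; the fixed field of `Aut_E(C₀)` is real

Theorems about the residue stubs of the two registered lines of the crux (A)
`RigidCore.AclSubsetLogFreeCore` (stmt-Schanuel-0968) — `stub_coreFixedLogFree` of
`Lines/eac-homogeneity-collapse.lean` (over `ExponentialRingEquiv C₀ C₀`) and
`stub_coreFixedField_logFree` of `Lines/eac-extends-core-automorphisms.lean` (over maps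
`g : ℂ → ℂ` with `IsEIsoOn g (ecl ∅) (ecl ∅)`), both of the form "`Fix(Aut_E(C₀)) ⊆ C_EA`":

* `conjExpEquiv : ExponentialRingEquiv ℂ ℂ` — conjugation is an E-field automorphism of `ℂ_exp`, so
  by functoriality of `ecl` (`Khovanskii.image_ecl_equiv`) it maps `ecl ∅` onto itself
  (`conj_image_ecl_empty`, `conj_mem_ecl_empty`) and restricts to `conjCore : ExponentialRingEquiv C₀ C₀`
  resp. satisfies `isEIsoOn_conj_ecl_empty` — `Aut_E(C₀)` is NOT trivial in either presentation, so the
  residue stubs are not the (SC-false) statement `ecl ∅ ⊆ C_EA` in disguise;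
* `exists_eq_ofReal_of_forall_equiv_fixed` / `exists_eq_ofReal_of_forall_isEIsoOn_fixed`: an element
  fixed by all of `Aut_E(C₀)` is REAL; hence both residue stubs are equivalent to their restrictions to
  real elements of `C₀` (`coreFixedLogFree_iff_real`, `coreFixedFieldLogFree_iff_real`) — the analogue for
  the lines of `aclSubsetLogFreeCore_iff_real` (`dcl(∅) ⊆ ℝ`).  With `conj` the presently known part of
  `Aut_E(C₀)` is exhausted: every instance of the stubs beyond "real" needs a NEW automorphism of the
  countable exponential field `C₀`.

## References

* [Kirby2010] J. Kirby, *Exponential algebraicity in exponential fields*, Bull. LMS 42 (2010),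
  Def. 3.2 / Lemma 3.3 (`ecl` is an invariant of the E-field structure).
-/

noncomputable section

set_option linter.dupNamespace false

open Literature.ModelTheory.ExponentialFields Literature.NumberTheory.Transcendental

namespace Summit.Schanuel.Schanuel.Theorems.AclSubsetLogFreeCore.Negative

/-- Complex conjugation as an isomorphism of exponential rings `ℂ_exp ≃ ℂ_exp`. -/
def conjExpEquiv : ExponentialRingEquiv ℂ ℂ where
  toRingEquiv := starRingAut
  map_exp' x := by
    change star (Complex.exp x) = Complex.exp (star x)
    exact (Complex.exp_conj x).symm

/-- `conjExpEquiv` is conjugation. -/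
@[simp] theorem conjExpEquiv_apply (z : ℂ) : conjExpEquiv z = (starRingEnd ℂ) z := rfl

/-- Conjugation maps the countable core `ecl ∅` onto itself (functoriality of `ecl`). -/
theorem conj_image_ecl_empty : (starRingEnd ℂ) '' ecl (∅ : Set ℂ) = ecl (∅ : Set ℂ) := by
  have h := Khovanskii.image_ecl_equiv conjExpEquiv (∅ : Set ℂ)
  rw [Set.image_empty] at h
  have hc : (⇑conjExpEquiv : ℂ → ℂ) = (starRingEnd ℂ) := funext fun z => rfl
  rw [hc] at h
  exact h

/-- `ecl ∅` is `conj`-stable. -/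
theorem conj_mem_ecl_empty {a : ℂ} (ha : a ∈ ecl (∅ : Set ℂ)) :
    (starRingEnd ℂ) a ∈ ecl (∅ : Set ℂ) := by
  rw [← conj_image_ecl_empty]; exact ⟨a, ha, rfl⟩

/-- Conjugation restricted to the countable core: an element of `Aut_E(C₀)` in the presentation of
line `eac-homogeneity-collapse` (`ExponentialRingEquiv C₀ C₀`, `C₀ = Khovanskii.eclSubfield ∅`). -/
def conjCore : ExponentialRingEquiv (Khovanskii.eclSubfield (∅ : Set ℂ))
    (Khovanskii.eclSubfield (∅ : Set ℂ)) where
  toFun a := ⟨(starRingEnd ℂ) a, conj_mem_ecl_empty a.2⟩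
  invFun a := ⟨(starRingEnd ℂ) a, conj_mem_ecl_empty a.2⟩
  left_inv a := Subtype.ext (Complex.conj_conj _)
  right_inv a := Subtype.ext (Complex.conj_conj _)
  map_mul' a b := Subtype.ext (map_mul (starRingEnd ℂ) _ _)
  map_add' a b := Subtype.ext (map_add (starRingEnd ℂ) _ _)
  map_exp' a := Subtype.ext (by
    change (starRingEnd ℂ) (Complex.exp (a : ℂ)) = Complex.exp ((starRingEnd ℂ) (a : ℂ))
    exact (Complex.exp_conj _).symm)

/-- `conjCore` is conjugation on coordinates. -/
@[simp] theorem coe_conjCore_apply (a : Khovanskii.eclSubfield (∅ : Set ℂ)) :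
    ((conjCore a : Khovanskii.eclSubfield (∅ : Set ℂ)) : ℂ) = (starRingEnd ℂ) a := rfl

/-- **An element of `C₀` fixed by every E-automorphism of `C₀` is real.** -/
theorem exists_eq_ofReal_of_forall_equiv_fixed (a : Khovanskii.eclSubfield (∅ : Set ℂ))
    (hfix : ∀ θ : ExponentialRingEquiv (Khovanskii.eclSubfield (∅ : Set ℂ))
      (Khovanskii.eclSubfield (∅ : Set ℂ)), θ a = a) :
    ∃ r : ℝ, (a : ℂ) = r := by
  have h := congrArg (fun x : Khovanskii.eclSubfield (∅ : Set ℂ) => (x : ℂ)) (hfix conjCore)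
  simp only [coe_conjCore_apply] at h
  obtain ⟨r, hr⟩ := Complex.conj_eq_iff_real.1 h
  exact ⟨r, hr⟩

/-- Hence `stub_coreFixedLogFree` (line `eac-homogeneity-collapse`) is equivalent to its restriction
to REAL elements of the core. -/
theorem coreFixedLogFree_iff_real :
    (∀ a : Khovanskii.eclSubfield (∅ : Set ℂ),
      (∀ θ : ExponentialRingEquiv (Khovanskii.eclSubfield (∅ : Set ℂ))
        (Khovanskii.eclSubfield (∅ : Set ℂ)), θ a = a) → (a : ℂ) ∈ logFreeCore) ↔
    (∀ a : Khovanskii.eclSubfield (∅ : Set ℂ), (∃ r : ℝ, (a : ℂ) = r) →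
      (∀ θ : ExponentialRingEquiv (Khovanskii.eclSubfield (∅ : Set ℂ))
        (Khovanskii.eclSubfield (∅ : Set ℂ)), θ a = a) → (a : ℂ) ∈ logFreeCore) :=
  ⟨fun h a _ hfix => h a hfix,
    fun h a hfix => h a (exists_eq_ofReal_of_forall_equiv_fixed a hfix) hfix⟩

/-- Conjugation in the presentation of line `eac-extends-core-automorphisms`: a map `ℂ → ℂ`
restricting to an E-field automorphism of `ecl ∅`. -/
theorem isEIsoOn_conj_ecl_empty :
    IsEIsoOn (starRingEnd ℂ) (ecl (∅ : Set ℂ)) (ecl (∅ : Set ℂ)) where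
  bijOn := ⟨fun _ ha => conj_mem_ecl_empty ha, (starRingEnd ℂ).injective.injOn,
    fun b hb => ⟨_, conj_mem_ecl_empty hb, Complex.conj_conj b⟩⟩
  map_add := fun u v _ _ => map_add _ u v
  map_mul := fun u v _ _ => map_mul _ u v
  map_exp := fun u _ => by
    change (starRingEnd ℂ) (Complex.exp u) = Complex.exp ((starRingEnd ℂ) u)
    exact (Complex.exp_conj u).symm

/-- **An element fixed by every `g` with `IsEIsoOn g (ecl ∅) (ecl ∅)` is real.** -/
theorem exists_eq_ofReal_of_forall_isEIsoOn_fixed {a : ℂ}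
    (hfix : ∀ g : ℂ → ℂ, IsEIsoOn g (ecl (∅ : Set ℂ)) (ecl (∅ : Set ℂ)) → g a = a) :
    ∃ r : ℝ, a = r := by
  obtain ⟨r, hr⟩ := Complex.conj_eq_iff_real.1 (hfix _ isEIsoOn_conj_ecl_empty)
  exact ⟨r, hr⟩

/-- Hence `stub_coreFixedField_logFree` (line `eac-extends-core-automorphisms`) is equivalent to its
restriction to REAL elements of `ecl ∅`. -/
theorem coreFixedFieldLogFree_iff_real :
    (∀ a ∈ ecl (∅ : Set ℂ),
      (∀ g : ℂ → ℂ, IsEIsoOn g (ecl (∅ : Set ℂ)) (ecl (∅ : Set ℂ)) → g a = a) →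
        a ∈ (logFreeCore : Set ℂ)) ↔
    (∀ a ∈ ecl (∅ : Set ℂ), (∃ r : ℝ, a = r) →
      (∀ g : ℂ → ℂ, IsEIsoOn g (ecl (∅ : Set ℂ)) (ecl (∅ : Set ℂ)) → g a = a) →
        a ∈ (logFreeCore : Set ℂ)) :=
  ⟨fun h a ha _ hfix => h a ha hfix,
    fun h a ha hfix => h a ha (exists_eq_ofReal_of_forall_isEIsoOn_fixed hfix) hfix⟩

/-- The fixed field of `Aut_E(C₀)` is `conj`-stable (indeed pointwise fixed by `conj`), and so is the
set of elements MOVED by some automorphism: `θ ↦ conjCore ∘ θ ∘ conjCore` is a bijection of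
`Aut_E(C₀)`.  (Bookkeeping for instance constructions: it suffices to move one of `a`, `conj a`.) -/
theorem exists_equiv_apply_ne_iff_conj (a : Khovanskii.eclSubfield (∅ : Set ℂ)) :
    (∃ θ : ExponentialRingEquiv (Khovanskii.eclSubfield (∅ : Set ℂ))
      (Khovanskii.eclSubfield (∅ : Set ℂ)), θ a ≠ a) ↔
    (∃ θ : ExponentialRingEquiv (Khovanskii.eclSubfield (∅ : Set ℂ))
      (Khovanskii.eclSubfield (∅ : Set ℂ)), θ (conjCore a) ≠ conjCore a) := by
  constructor
  · rintro ⟨θ, hθ⟩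
    refine ⟨(conjCore.trans θ).trans conjCore, fun h => hθ ?_⟩
    have hcc : ∀ x, conjCore (conjCore x) = x := fun x => Subtype.ext (Complex.conj_conj _)
    have h2 := congrArg conjCore h
    simpa [hcc] using h2
  · rintro ⟨θ, hθ⟩
    refine ⟨(conjCore.trans θ).trans conjCore, fun h => hθ ?_⟩
    have hcc : ∀ x, conjCore (conjCore x) = x := fun x => Subtype.ext (Complex.conj_conj _)
    have h2 := congrArg conjCore h
    simpa [hcc] using h2

end Summit.Schanuel.Schanuel.Theorems.AclSubsetLogFreeCore.Negative
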